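import Summits.Ventures.PercRepro.Night2LocalTwoTwoX

/-!
# PercRepro — facts about planes for the scheme S6 (night-2, gen 9)

If a plane `P` is a line `L` plus one point `z` (`m = 1` in NIGHT-2-local.md §19 ADDENDUM 8), no subset `B ⊆ P`
has both `ρ(B) = 3` and `ρ(P ∖ B) = 3`: every spanning subset contains `z`, so its complement lies in `L`.
-/

namespace PercRepro.Shadow

open Finset PerFlat ThmH

variable {α : Type*} [DecidableEq α] {M : Matroid α} [M.Finite]

/-- A subset of a set of rank `≤ 2` that does not contain `z` has rank `≤ 2`. -/
theorem rkN_le_two_of_subset_insert {L : Finset α} (hL : rkN M L ≤ 2) {z : α} {B : Finset α}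
    (hB : B ⊆ insert z L) (hz : z ∉ B) : rkN M B ≤ 2 := by
  have hBL : B ⊆ L := by
    intro e he
    have := hB he
    rw [Finset.mem_insert] at this
    rcases this with rfl | h
    · exact absurd he hz
    · exact h
  exact (rkN_mono hBL).trans hL

/-- **`m = 1` kills the layer-`0` members**: if `P = L ∪ {z}` with `ρ(L) ≤ 2`, no `B ⊆ P` has `ρ(B) = 3` and
`ρ(P ∖ B) = 3`. -/
theorem not_rkN_eq_three_and_sdiff_of_eq_insert {L : Finset α} (hL : rkN M L ≤ 2) {z : α} {B : Finset α}
    (hB : B ⊆ insert z L) : ¬ (rkN M B = 3 ∧ rkN M (insert z L \ B) = 3) := by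
  rintro ⟨h1, h2⟩
  by_cases hz : z ∈ B
  · have : z ∉ insert z L \ B := fun h => (Finset.mem_sdiff.1 h).2 hz
    have := rkN_le_two_of_subset_insert hL Finset.sdiff_subset this
    omega
  · have := rkN_le_two_of_subset_insert hL hB hz
    omega

end PercRepro.Shadow
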